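import Literature.Analysis.FluidPDE.PassiveVectorLayerLadder
import Summits.AnomalousDissipation.AnomalousDissipation.Theorems.SolenoidalFractalHomogenisationRealisedQuasiStaticCellLawSectorExists
import HarnessLib

/-!
# K2R `RealisedQuasiStaticCellLaw`, line `floquet-bloch`: the Galerkin system of a lattice-word cell in ladder form
# (helper towards the registered stub `stub_lowSectorDecay`, S1D; `--supports stmt-AnomalousDissipation-20446`)

Summits-side helper file (everything proved; no definitions, no named facts). For a lattice word `W`, a cell number
`n ≥ 1` and a time `t`:

* `mFourierCoeff_cell`: the Fourier coefficients of the cell slice `(W.cell n) t` are the envelope-weighted two-mode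
  layer coefficients `∑ⱼ ((1/n)·trap_j(t)) • C_j(k)`, `C_j` supported on `±K_j`, `K_j i = m_j i · n`
  (from `complexify_comp_cell_eq_trigPoly`);
* `pvSetup_cell`: for `κ ≥ 0`, a Bloch sector `±ℓ + nℤ³` and an `H¹` weakly divergence-free mean-zero datum supported in
  the sector, the data `Torus.PVSetup κ (W.cell n) B β (k₀/(2π)) Sec w₀` of the Fourier–Galerkin scheme
  (`PassiveVectorGalerkinLimit`) — the constructor used inside `stub_sectorExists`, exported for the S1D files;
* `pvGalerkinField_cell`: **the Galerkin field around the cell carrier in ladder form** — on any symmetric frequency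
  set `S ⊇ B` and for states `c` vanishing off `S`,
  `V(c)_k = -κ4π²|k|² c_k - ∑ⱼ ((1/n) trap_j(t) · 2πi (ê_j·k)) • Π_k (a_j • c(k - K_j) + a'_j • c(k + K_j))`
  (`Torus.pvGalerkinField_layers` of `PassiveVectorLayerLadder`; STUB-PLAN `stub_lowSectorDecay` §1).
-/

set_option linter.dupNamespace false

noncomputable section

namespace Summit.AnomalousDissipation.AnomalousDissipation.Theorems.SolenoidalFractalHomogenisation.RealisedQuasiStaticCellLaw

open Set MeasureTheory Filter Topology Function
open scoped InnerProductSpace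
open Literature.Analysis Literature.Analysis.FunctionSpaces Literature.Analysis.FunctionSpaces.Torus
open Literature.Analysis.FluidPDE Literature.Analysis.FluidPDE.LatticeShear
open Summit.AnomalousDissipation.AnomalousDissipation.Theorems.SolenoidalFractalHomogenisation.PermissibleCarrier

variable {k₀ : ℕ}

/-- The cell frequency `K_j` (`K_j i = m_j i · n`) of a slot is non-zero for `n ≥ 1`. -/
theorem cellFreq_ne_zero (P : LatticePhase) {n : ℕ} (hn : 0 < n) : (fun i => P.m i * (n : ℤ)) ≠ 0 := by
  intro h
  apply P.m_ne
  funext i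
  have hi := congrFun h i
  simp only [Pi.zero_apply, mul_eq_zero, Int.natCast_eq_zero] at hi
  rcases hi with hi | hi
  · exact hi
  · exact absurd hi hn.ne'

/-- The complexified polarisation of a slot is transversal to its cell frequency: `∑ᵢ (m i · n) (ê i : ℂ) = 0`. -/
theorem sum_cellFreq_mul_complexify_e (P : LatticePhase) (n : ℕ) :
    ∑ i, (((fun i => P.m i * (n : ℤ)) i : ℤ) : ℂ) * (EuclideanSpace.complexify P.e) i = 0 := by
  have h := P.e_perp
  rw [EuclideanSpace.inner_eq_star_dotProduct] at h
  have h' : ∑ i : Fin 3, (P.m i : ℝ) * P.e i = 0 := by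
    simpa [dotProduct, latticeVec_apply, mul_comm] using h
  have h2 : ∑ i, (((fun i => P.m i * (n : ℤ)) i : ℤ) : ℂ) * (EuclideanSpace.complexify P.e) i =
      (n : ℂ) * ((∑ i : Fin 3, (P.m i : ℝ) * P.e i : ℝ) : ℂ) := by
    push_cast
    rw [Finset.mul_sum]
    refine Finset.sum_congr rfl fun i _ => ?_
    rw [EuclideanSpace.complexify_apply]
    push_cast
    ring
  rw [h2, h', Complex.ofReal_zero, mul_zero]

/-- **The Fourier coefficients of the cell slice**: envelope-weighted two-mode layer coefficients. -/
theorem mFourierCoeff_cell (W : LatticeWord k₀) {n : ℕ} (hn : 0 < n) (t : ℝ) (k : Fin 3 → ℤ) :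
    UnitAddTorus.mFourierCoeff (EuclideanSpace.complexify ∘ W.cell n t) k =
      ∑ j : Fin k₀, (((1 / (n : ℝ)) *
          LatticeWord.trapezoid (W.start j) (W.phase j).τ W.ramp (Int.fract (t / W.period) * W.period) : ℝ) : ℂ) •
        (((if k = (fun i => (W.phase j).m i * n) then
            Complex.exp ((W.phase j).φ * Complex.I) *
              (1 / (2 * ((2 * Real.pi * ‖latticeVec (W.phase j).m‖ : ℝ) : ℂ) * Complex.I)) else 0) +
          (if k = -(fun i => (W.phase j).m i * n) then
            starRingEnd ℂ (Complex.exp ((W.phase j).φ * Complex.I)) *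
              (-(1 / (2 * ((2 * Real.pi * ‖latticeVec (W.phase j).m‖ : ℝ) : ℂ) * Complex.I))) else 0)) •
          EuclideanSpace.complexify (W.phase j).e) := by
  classical
  rw [complexify_comp_cell_eq_trigPoly W hn t, Torus.mFourierCoeff_trigPoly]
  split_ifs with hk
  · rfl
  · symm
    refine Finset.sum_eq_zero fun j _ => ?_
    have hk1 : k ≠ (fun i => (W.phase j).m i * n) := by
      intro h
      apply hk
      rw [Finset.mem_biUnion]
      exact ⟨j, Finset.mem_univ _, by rw [h]; exact Finset.mem_insert_self _ _⟩
    have hk2 : k ≠ -(fun i => (W.phase j).m i * n) := by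
      intro h
      apply hk
      rw [Finset.mem_biUnion]
      exact ⟨j, Finset.mem_univ _, by rw [h]; exact Finset.mem_insert_of_mem (Finset.mem_singleton_self _)⟩
    rw [if_neg hk1, if_neg hk2, add_zero, zero_smul, smul_zero]

/-- **The Galerkin data of a lattice-word cell in one Bloch sector** (`Torus.PVSetup`): viscosity `κ ≥ 0`, the cell
carrier as a trigonometric-polynomial carrier (`trigPolyCarrier_cell`), the sector `±ℓ + nℤ³` (stable under the carrier
frequencies `± n m_j`), and an `H¹` weakly divergence-free mean-zero datum supported in the sector. -/
theorem pvSetup_cell (W : LatticeWord k₀) {n : ℕ} (hn : 0 < n) {κ : ℝ} (hκ : 0 ≤ κ) (ℓ : Fin 3 → ℤ)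
    {w₀ : UnitAddTorus (Fin 3) → EuclideanSpace ℝ (Fin 3)}
    (hw₀ : FunctionSpaces.Torus.MemSobolev 1 (FunctionSpaces.EuclideanSpace.complexify ∘ w₀))
    (hdiv : FunctionSpaces.Torus.IsWeaklyDivFree w₀) (hmean : FunctionSpaces.Torus.HasZeroMean w₀)
    (hsupp : ∀ k : Fin 3 → ℤ, ¬ ((∃ z : Fin 3 → ℤ, k = ℓ + (n:ℤ) • z) ∨ (∃ z : Fin 3 → ℤ, k = -ℓ + (n:ℤ) • z)) →
      UnitAddTorus.mFourierCoeff (FunctionSpaces.EuclideanSpace.complexify ∘ w₀) k = 0) :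
    Torus.PVSetup κ (W.cell n)
      (Finset.univ.biUnion fun j : Fin k₀ =>
        ({(fun i => (W.phase j).m i * n), -(fun i => (W.phase j).m i * n)} : Finset (Fin 3 → ℤ)))
      (fun t k => UnitAddTorus.mFourierCoeff (EuclideanSpace.complexify ∘ W.cell n t) k) (k₀ / (2 * Real.pi))
      {k | (∃ z : Fin 3 → ℤ, k = ℓ + (n:ℤ) • z) ∨ (∃ z : Fin 3 → ℤ, k = -ℓ + (n:ℤ) • z)} w₀ := by
  classical
  set Sec : Set (Fin 3 → ℤ) := {k | (∃ z : Fin 3 → ℤ, k = ℓ + (n:ℤ) • z) ∨ (∃ z : Fin 3 → ℤ, k = -ℓ + (n:ℤ) • z)}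
    with hSec
  have hsector : ∀ k l : Fin 3 → ℤ, l ∈ (Finset.univ.biUnion fun j : Fin k₀ =>
      ({(fun i => (W.phase j).m i * n), -(fun i => (W.phase j).m i * n)} : Finset (Fin 3 → ℤ))) →
      k - l ∈ Sec → k ∈ Sec := by
    intro k l hl hkl
    simp only [Finset.mem_biUnion, Finset.mem_univ, true_and, Finset.mem_insert, Finset.mem_singleton] at hl
    obtain ⟨j, hj⟩ := hl
    have hl' : ∃ μ : Fin 3 → ℤ, l = (n:ℤ) • μ := by
      rcases hj with hj | hj
      · exact ⟨(W.phase j).m, by rw [hj]; funext i; simp [mul_comm]⟩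
      · exact ⟨-(W.phase j).m, by rw [hj]; funext i; simp [mul_comm]⟩
    obtain ⟨μ, rfl⟩ := hl'
    have ek : k = (k - (n:ℤ) • μ) + (n:ℤ) • μ := (sub_add_cancel k _).symm
    rcases hkl with ⟨z, hz⟩ | ⟨z, hz⟩
    · left
      exact ⟨z + μ, by rw [ek, hz, smul_add]; abel⟩
    · right
      exact ⟨z + μ, by rw [ek, hz, smul_add]; abel⟩
  have hmemLp : MemLp w₀ 2 volume := memLp_two_of_memSobolev_one_complexify hw₀
  have hzero : UnitAddTorus.mFourierCoeff (FunctionSpaces.EuclideanSpace.complexify ∘ w₀) 0 = 0 := by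
    rw [mFourierCoeff_complexify_zero_eq_mean (hmemLp.integrable one_le_two)]
    have h0 : ∫ x, w₀ x = 0 := hmean
    rw [h0, map_zero]
  exact ⟨hκ, trigPolyCarrier_cell W hn, hsector, hmemLp, hdiv, hzero, fun k hk => hsupp k hk⟩

/-- **The Galerkin field around a lattice-word cell, in ladder form** (`Torus.pvGalerkinField_layers`): on a symmetric
frequency set `S` containing the carrier frequencies `± K_j` (`K_j i = m_j i · n`), for every state `c` vanishing off `S`,
`V(c)_k = -κ4π²|k|² c_k - ∑ⱼ ((1/n)·trap_j(t) · 2πi (ê_j·k)) • Π_k (a_j • c(k - K_j) + a'_j • c(k + K_j))`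
with `a_j = e^{iφ_j}/(2·(2π|m_j|)·i)`, `a'_j = -conj(e^{iφ_j})/(2·(2π|m_j|)·i)`: mode `k` is coupled only to
`k ∓ n m_j`, slot by slot, with the envelope weight of the slot. -/
theorem pvGalerkinField_cell (W : LatticeWord k₀) {n : ℕ} (hn : 0 < n) (κ : ℝ) {S : Finset (Fin 3 → ℤ)}
    (hBS : (Finset.univ.biUnion fun j : Fin k₀ =>
        ({(fun i => (W.phase j).m i * n), -(fun i => (W.phase j).m i * n)} : Finset (Fin 3 → ℤ))) ⊆ S)
    {c : (Fin 3 → ℤ) → EuclideanSpace ℂ (Fin 3)} (hc : ∀ m, m ∉ S → c m = 0) (t : ℝ) (k : Fin 3 → ℤ) :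
    Torus.pvGalerkinField κ S (fun l => UnitAddTorus.mFourierCoeff (EuclideanSpace.complexify ∘ W.cell n t) l) c k =
      -(((κ * (4 * Real.pi ^ 2 * freqNormSq k) : ℝ) : ℂ) • c k) -
        ∑ j : Fin k₀, ((((1 / (n : ℝ)) *
            LatticeWord.trapezoid (W.start j) (W.phase j).τ W.ramp (Int.fract (t / W.period) * W.period) : ℝ) : ℂ) *
            (2 * Real.pi * Complex.I * ∑ i, (EuclideanSpace.complexify (W.phase j).e) i * (k i : ℂ))) •
          Torus.leraySym k
            ((Complex.exp ((W.phase j).φ * Complex.I) *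
                (1 / (2 * ((2 * Real.pi * ‖latticeVec (W.phase j).m‖ : ℝ) : ℂ) * Complex.I))) •
                c (k - (fun i => (W.phase j).m i * n)) +
              (starRingEnd ℂ (Complex.exp ((W.phase j).φ * Complex.I)) *
                (-(1 / (2 * ((2 * Real.pi * ‖latticeVec (W.phase j).m‖ : ℝ) : ℂ) * Complex.I)))) •
                c (k + (fun i => (W.phase j).m i * n))) := by
  classical
  have e1 : (fun l => UnitAddTorus.mFourierCoeff (EuclideanSpace.complexify ∘ W.cell n t) l) =
      fun l => ∑ j : Fin k₀, (((1 / (n : ℝ)) *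
          LatticeWord.trapezoid (W.start j) (W.phase j).τ W.ramp (Int.fract (t / W.period) * W.period) : ℝ) : ℂ) •
        (((if l = (fun i => (W.phase j).m i * n) then
            Complex.exp ((W.phase j).φ * Complex.I) *
              (1 / (2 * ((2 * Real.pi * ‖latticeVec (W.phase j).m‖ : ℝ) : ℂ) * Complex.I)) else 0) +
          (if l = -(fun i => (W.phase j).m i * n) then
            starRingEnd ℂ (Complex.exp ((W.phase j).φ * Complex.I)) *
              (-(1 / (2 * ((2 * Real.pi * ‖latticeVec (W.phase j).m‖ : ℝ) : ℂ) * Complex.I))) else 0)) •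
          EuclideanSpace.complexify (W.phase j).e) := funext fun l => mFourierCoeff_cell W hn t l
  rw [e1]
  have hK : ∀ j ∈ (Finset.univ : Finset (Fin k₀)), (fun i => (W.phase j).m i * (n : ℤ)) ≠ 0 :=
    fun j _ => cellFreq_ne_zero (W.phase j) hn
  have hKS : ∀ j ∈ (Finset.univ : Finset (Fin k₀)), (fun i => (W.phase j).m i * (n : ℤ)) ∈ S := fun j _ =>
    hBS (Finset.mem_biUnion.2 ⟨j, Finset.mem_univ _, Finset.mem_insert_self _ _⟩)
  have hKS' : ∀ j ∈ (Finset.univ : Finset (Fin k₀)), -(fun i => (W.phase j).m i * (n : ℤ)) ∈ S := fun j _ =>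
    hBS (Finset.mem_biUnion.2 ⟨j, Finset.mem_univ _, Finset.mem_insert_of_mem (Finset.mem_singleton_self _)⟩)
  have he : ∀ j ∈ (Finset.univ : Finset (Fin k₀)),
      ∑ i, (((fun i => (W.phase j).m i * (n : ℤ)) i : ℤ) : ℂ) * (EuclideanSpace.complexify (W.phase j).e) i = 0 :=
    fun j _ => sum_cellFreq_mul_complexify_e (W.phase j) n
  exact Torus.pvGalerkinField_layers κ Finset.univ hK hKS hKS' he _ _ _ hc k

end Summit.AnomalousDissipation.AnomalousDissipation.Theorems.SolenoidalFractalHomogenisation.RealisedQuasiStaticCellLaw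

end
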